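import Summits.BirchSwinnertonDyer.Rank1Residual.GaloisImage.KolyvaginPrimeLocalShape
import Literature.NumberTheory.GaloisRepresentations.ContinuousH1
import HarnessLib

/-!
# The prime-choice local criterion: `loc_v [c] = 0 ↔ c(Frob_v) ∈ (Frob_v − 1)T̄` for an unramified class
# (cell `b2b-bsdres`, team n1011, row T-C55K, file 3/5 — LOCAL GALOIS COHOMOLOGY; seat p15)

HONEST FRAMING (cell `b2b-bsdres`, run/shared/lean/b2b/bsd-rank1-residual/, verbatim in every
file): the goal of the cell is to DELETE the COMBINATION-SHAPED residual classes of the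
Birch–Swinnerton-Dyer formula for ALL analytic-rank `≤ 1` elliptic curves over `ℚ` — "full BSD
formula for every rank `≤ 1` curve in class `C`" assembled STRICTLY from published theorems — so
that the rank-`≤ 1` remainder becomes exactly the CONSTRUCTION-SHAPED classes, which are TYPED
(missing-input `Prop`s), NOT attempted. This is not "finishing BSD". Team n1011 (N10/N11, the
additive block `X4 ∧ p = 3`): research route; TOOL theorems of local Galois cohomology, no class
theorem, nothing booked, no mark changed; no definition, no named fact.

## What and why

The Chebotarev step of Sakamoto's Lemma 5.2 / Mazur–Rubin's Prop. 3.6.1 reads the condition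
"`loc_𝔮(c) ≠ 0`" off a Frobenius: for a place `v` at which both the module `T̄` and the class `c`
are unramified, `loc_v(c) = 0` iff `c(Frob_v) ∈ (Frob_v − 1)T̄` — because
`H¹_ur(K_v, T̄) = H¹(K_v^{nr}/K_v, T̄) ≅ T̄/(Frob_v − 1)T̄` by evaluation at the Frobenius
(Mazur–Rubin Lemma 1.2.1; Rubin PCMI Prop. 1.4.13 (1); Serre, *Local Fields*, XIII §1).  This file
proves that criterion in the tree's vocabulary, for ANY arithmetic Frobenius `σ ∈ Γ_K` at ANY prime
`𝔓 ∣ v` of `\bar ℤ_K` (the shape delivered by the tree's Chebotarev theorem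
`absoluteGaloisGroup.frobenius_dense`):

* `contOneCocycles_eq_zero_of_absInertia_of_frob` — over a non-archimedean local field `L`, a
  continuous crossed homomorphism of `Γ_L` that vanishes on the inertia group and at one arithmetic
  Frobenius vanishes identically (it is right-invariant under an open normal subgroup, and
  Frobenius generates `Γ_L / (U · I_L)`: tree `exists_pow_eq_mk`);
* `apply_conj_eq`, `range_sub_id_conj`, `apply_mem_range_conj_iff` — the cocycle identity
  `c(g s g⁻¹) = ρ(g) c(s) − (ρ(g s g⁻¹) − 1) c(g)` and its consequence
  `c(g s g⁻¹) ∈ (ρ(g s g⁻¹) − 1)T̄ ↔ c(s) ∈ (ρ(s) − 1)T̄` (the condition depends only on the place);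
* `localization_oneCocycleClass_eq_zero_iff_of_isArithFrobAt` — MAIN: for `v` with `ρ` unramified
  at `v`, `c` vanishing on the inertia groups above `v`, and `σ` an arithmetic Frobenius at some
  `𝔓 ∣ v`: **`loc_v [c] = 0 ↔ c(σ) ∈ (ρ(σ) − 1)T̄`** (at the prime `𝔓₀` of the completion via the
  local Frobenius and `DecompositionGroupOfCompletion`; transported to any `𝔓 = g • 𝔓₀` by
  `Γ_K`-transitivity, `IsArithFrobAt.conj`, `IsArithFrobAt.mul_inv_mem_inertia`).

References: B. Mazur, K. Rubin, *Kolyvagin systems*, Mem. AMS 799 (2004), Lemma 1.2.1 and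
Prop. 3.6.1 (proof, p. 31: "`(c_i)_ℓ ≠ 0 ⟺ c_i(Fr_ℓ) ∉ (Fr_ℓ − 1)T`"); K. Rubin, *Euler systems and
Kolyvagin systems* (PCMI 18, 2011), Prop. 1.4.13 (1); J.-P. Serre, *Local Fields*, XIII §1;
J. Neukirch, *Algebraic Number Theory*, II (9.6).
-/

noncomputable section

open Function Field NumberField IsDedekindDomain ValuativeRel
open Literature.NumberTheory.GaloisRepresentations
open Literature.NumberTheory.GaloisRepresentations.IsNonarchimedeanLocalField
open scoped NumberField Pointwise

universe u

namespace Summit.BirchSwinnertonDyer.Rank1Residual.GaloisImage.PrimeChoice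

/-! ## §1. Local: a cocycle vanishing on inertia and at a Frobenius is zero -/

section Local

variable {L : Type u} [Field L] [ValuativeRel L] [TopologicalSpace L] [IsNonarchimedeanLocalField L]
variable {M : Type u} [AddCommGroup M] [TopologicalSpace M] [DiscreteTopology M]

/-- **A continuous crossed homomorphism of `Γ_L` vanishing on the inertia group `I_L` and at an
arithmetic Frobenius `φ₀` is zero.**  (`ψ` is right-invariant under an open normal subgroup `W`
— uniform local constancy on the compact `Γ_L` — hence vanishes on `U = W · I_L`; every element of
`Γ_L` is `φ₀ⁱ u` with `u ∈ U` (`exists_pow_eq_mk`), and `ψ(φ₀ⁱ) = 0` by the cocycle rule.)  This is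
the injectivity half of `H¹(L^{nr}/L, T̄) ≅ T̄/(Frob − 1)T̄`, `[ψ] ↦ ψ(Frob)` (Rubin PCMI
Prop. 1.4.13 (1); Serre, *Local Fields*, XIII §1 Prop. 1).
[cite: Rubin2011, Prop. 1.4.13 (1) (p. 9)] [cite: SerreLocalFields1979, XIII §1 Prop. 1] -/
theorem contOneCocycles_eq_zero_of_absInertia_of_frob (π : DiscreteGaloisModule L M)
    (ψ : contOneCocycles π.toTopRep) (hI : ∀ t ∈ absInertia L, ψ.1 t = 0)
    {φ₀ : absoluteGaloisGroup L} (hφ₀ : IsFrobPow φ₀ 1) (h0 : ψ.1 φ₀ = 0) : ψ = 0 := by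
  haveI := absoluteGaloisGroup_compactSpace L
  -- right-invariance under an open normal subgroup `W`
  obtain ⟨V, hV, hVψ⟩ := exists_nhds_one_forall_eq' (X := absoluteGaloisGroup L)
    (P := absoluteGaloisGroup L) (fun a b => ψ.1 (a * b)) (ψ.1.continuous.comp continuous_mul)
  have h1 : (1 : absoluteGaloisGroup L) ∈ interior V := mem_interior_iff_mem_nhds.2 hV
  obtain ⟨W, hW⟩ := ProfiniteGrp.exist_openNormalSubgroup_sub_open_nhds_of_one isOpen_interior h1
  have hWψ : ∀ a : absoluteGaloisGroup L, ∀ w ∈ (W : Subgroup (absoluteGaloisGroup L)),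
      ψ.1 (a * w) = ψ.1 a := by
    intro a w hw
    have h := hVψ a w (interior_subset (hW hw))
    rwa [mul_one] at h
  -- the open normal subgroup `U = W · I_L ⊇ I_L`, on which `ψ` vanishes
  haveI := absInertia_normal_holds L
  set U : Subgroup (absoluteGaloisGroup L) := (W : Subgroup (absoluteGaloisGroup L)) ⊔ absInertia L
    with hU_def
  have hUo : IsOpen (U : Set (absoluteGaloisGroup L)) :=
    Subgroup.isOpen_mono (le_sup_left : (W : Subgroup (absoluteGaloisGroup L)) ≤ U) W.isOpen'
  have hIU : absInertia L ≤ U := le_sup_right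
  have hUψ : ∀ u ∈ U, ψ.1 u = 0 := by
    intro u hu
    have hu' : u ∈ ((W : Subgroup (absoluteGaloisGroup L)) : Set (absoluteGaloisGroup L)) *
        (absInertia L : Set (absoluteGaloisGroup L)) := by
      rw [← Subgroup.normal_mul]; exact hu
    obtain ⟨w, hw, t, ht, rfl⟩ := Set.mem_mul.1 hu'
    rw [ψ.2 w t, hI t ht, map_zero, add_zero]
    have h := hWψ 1 w hw
    rwa [one_mul, contOneCocycles.apply_one] at h
  -- powers of the Frobenius
  have hpow : ∀ i : ℕ, ψ.1 (φ₀ ^ i) = 0 := fun i => by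
    induction i with
    | zero => rw [pow_zero]; exact contOneCocycles.apply_one ψ
    | succ i ih => rw [pow_succ, ψ.2, ih, h0, map_zero, zero_add]
  -- every element is `φ₀ⁱ u⁻¹`
  refine Subtype.ext (ContinuousMap.ext fun t => ?_)
  obtain ⟨i, hi⟩ := exists_pow_eq_mk L hUo hIU hφ₀ (QuotientGroup.mk t)
  rw [← QuotientGroup.mk_pow, QuotientGroup.eq] at hi
  have ht : t = φ₀ ^ i * (t⁻¹ * φ₀ ^ i)⁻¹ := by group
  change ψ.1 t = 0
  rw [ht, ψ.2, hpow, hUψ _ (U.inv_mem hi), map_zero, zero_add]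

end Local

/-! ## §2. Conjugation invariance of the condition `c(s) ∈ (ρ(s) − 1)T̄` -/

section Conj

variable {K : Type u} [Field K] {M : Type u} [AddCommGroup M] [TopologicalSpace M]
  [DiscreteTopology M] {ρ : DiscreteGaloisModule K M}

/-- `c(g⁻¹) = −ρ(g⁻¹) c(g)` for a crossed homomorphism. [folklore] -/
theorem apply_inv_eq (c : contOneCocycles ρ.toTopRep) (g : absoluteGaloisGroup K) :
    c.1 g⁻¹ = -ρ g⁻¹ (c.1 g) := by
  have h : c.1 (g⁻¹ * g) = c.1 g⁻¹ + ρ g⁻¹ (c.1 g) := c.2 g⁻¹ g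
  rw [inv_mul_cancel, contOneCocycles.apply_one] at h
  exact eq_neg_of_add_eq_zero_left h.symm

/-- **The cocycle identity under conjugation**: `c(g s g⁻¹) = ρ(g) c(s) − (ρ(g s g⁻¹) − 1) c(g)`.
[folklore] -/
theorem apply_conj_eq (c : contOneCocycles ρ.toTopRep) (g s : absoluteGaloisGroup K) :
    c.1 (g * s * g⁻¹) = ρ g (c.1 s) - (ρ (g * s * g⁻¹) (c.1 g) - c.1 g) := by
  have h1 : c.1 (g * s * g⁻¹) = c.1 g + ρ g (c.1 s + ρ s (c.1 g⁻¹)) := by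
    rw [mul_assoc, c.2 g (s * g⁻¹), c.2 s g⁻¹]; rfl
  rw [h1, apply_inv_eq]
  simp only [map_add, map_neg, map_mul, Module.End.mul_apply]
  abel

/-- `(ρ(g s g⁻¹) − 1)T̄ = ρ(g) · (ρ(s) − 1)T̄`. [folklore] -/
theorem range_sub_id_conj (g s : absoluteGaloisGroup K) :
    ((ρ (g * s * g⁻¹)).toAddMonoidHom - AddMonoidHom.id M).range =
      (((ρ s).toAddMonoidHom - AddMonoidHom.id M).range).map (ρ g).toAddMonoidHom := by
  have hginv : ∀ m : M, ρ g (ρ g⁻¹ m) = m := fun m => by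
    rw [← Module.End.mul_apply, ← map_mul, mul_inv_cancel, map_one, Module.End.one_apply]
  have hginv' : ∀ m : M, ρ g⁻¹ (ρ g m) = m := fun m => by
    rw [← Module.End.mul_apply, ← map_mul, inv_mul_cancel, map_one, Module.End.one_apply]
  ext x
  simp only [AddMonoidHom.mem_range, AddMonoidHom.sub_apply, LinearMap.toAddMonoidHom_coe,
    AddMonoidHom.id_apply, AddSubgroup.mem_map]
  constructor
  · rintro ⟨m, rfl⟩
    refine ⟨ρ s (ρ g⁻¹ m) - ρ g⁻¹ m, ⟨ρ g⁻¹ m, rfl⟩, ?_⟩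
    rw [map_sub, map_mul, map_mul, Module.End.mul_apply, Module.End.mul_apply, hginv]
  · rintro ⟨_, ⟨m, rfl⟩, rfl⟩
    refine ⟨ρ g m, ?_⟩
    rw [map_sub, map_mul, map_mul, Module.End.mul_apply, Module.End.mul_apply, hginv']

/-- **`c(g s g⁻¹) ∈ (ρ(g s g⁻¹) − 1)T̄ ↔ c(s) ∈ (ρ(s) − 1)T̄`** — the condition
"`c(Fr) ∉ (Fr − 1)T̄`" of Mazur–Rubin p. 31 depends only on the conjugacy class of the Frobenius.
[cite: MazurRubin2004, Prop. 3.6.1 proof, p. 31] -/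
theorem apply_mem_range_conj_iff (c : contOneCocycles ρ.toTopRep) (g s : absoluteGaloisGroup K) :
    c.1 (g * s * g⁻¹) ∈ ((ρ (g * s * g⁻¹)).toAddMonoidHom - AddMonoidHom.id M).range ↔
      c.1 s ∈ ((ρ s).toAddMonoidHom - AddMonoidHom.id M).range := by
  set R' := ((ρ (g * s * g⁻¹)).toAddMonoidHom - AddMonoidHom.id M).range with hR'
  have hmem : ρ (g * s * g⁻¹) (c.1 g) - c.1 g ∈ R' := ⟨c.1 g, rfl⟩
  have hiff : c.1 (g * s * g⁻¹) ∈ R' ↔ ρ g (c.1 s) ∈ R' := by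
    rw [apply_conj_eq]
    exact ⟨fun h => by simpa using R'.add_mem h hmem, fun h => R'.sub_mem h hmem⟩
  rw [hiff, hR', range_sub_id_conj, AddSubgroup.mem_map]
  constructor
  · rintro ⟨y, hy, hyx⟩
    have hinj : y = c.1 s := by
      have h := congrArg (ρ g⁻¹) hyx
      rwa [LinearMap.toAddMonoidHom_coe, ← Module.End.mul_apply, ← map_mul, inv_mul_cancel,
        map_one, Module.End.one_apply, ← Module.End.mul_apply, ← map_mul, inv_mul_cancel, map_one,
        Module.End.one_apply] at h
    exact hinj ▸ hy
  · intro h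
    exact ⟨c.1 s, h, rfl⟩

/-- If `ρ i = 1` and `c(i) = 0` then the condition at `i s` is the condition at `s`:
`c(i s) = c(s)`, `ρ(i s) = ρ(s)`. [folklore] -/
theorem apply_mem_range_mul_iff_of_apply_eq_one (c : contOneCocycles ρ.toTopRep)
    {i : absoluteGaloisGroup K} (hρi : ρ i = 1) (hci : c.1 i = 0) (s : absoluteGaloisGroup K) :
    c.1 (i * s) ∈ ((ρ (i * s)).toAddMonoidHom - AddMonoidHom.id M).range ↔
      c.1 s ∈ ((ρ s).toAddMonoidHom - AddMonoidHom.id M).range := by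
  have h1 : c.1 (i * s) = c.1 s := by
    rw [c.2 i s, hci, zero_add]
    change ρ i (c.1 s) = c.1 s
    rw [hρi, Module.End.one_apply]
  rw [h1, map_mul, hρi, one_mul]

end Conj

/-! ## §3. The criterion over a number field -/

section Global

variable {K : Type u} [Field K] [NumberField K] {M : Type u} [AddCommGroup M] [TopologicalSpace M]
  [DiscreteTopology M] (ρ : DiscreteGaloisModule K M)

/-- The localisation at a finite place on classes of continuous crossed homomorphisms:
`loc_v [c] = [c ∘ res_v]` (`map_oneCocycleClass`; `res_v = absGaloisRestrict K K_v`).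
[folklore] -/
theorem localization_inr_oneCocycleClass (v : HeightOneSpectrum (𝓞 K))
    (c : contOneCocycles ρ.toTopRep) :
    galoisCohomology.localization ρ (Sum.inr v) 1 (oneCocycleClass ρ.toTopRep c) =
      oneCocycleClass (DiscreteGaloisModule.toTopRep (GaloisRep.restrictField (v.adicCompletion K) ρ))
        (contOneCocycles.pullback (absGaloisRestrict K (v.adicCompletion K))
          (X := ρ.toTopRep)
          (Y := DiscreteGaloisModule.toTopRep (GaloisRep.restrictField (v.adicCompletion K) ρ))
          (TopRep.ofHom ⟨ContinuousLinearMap.id ℤ M, fun _ => rfl⟩) c) :=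
  map_oneCocycleClass _ _ _ c

/-- **MAIN (local criterion).**  Let `v` be a finite place of the number field `K` at which the
finite discrete module `ρ` (= `T̄`) is unramified, `c : Γ_K → T̄` a continuous crossed homomorphism
vanishing on every inertia group `I_𝔓`, `𝔓 ∣ v`, and `σ ∈ Γ_K` an arithmetic Frobenius at some
`𝔓 ∣ v`.  Then **`loc_v [c] = 0 ↔ c(σ) ∈ (ρ(σ) − 1)T̄`** — Mazur–Rubin's "`(c)_ℓ ≠ 0` iff
`c(Fr_ℓ) ∉ (Fr_ℓ − 1)T`" (proof of Prop. 3.6.1, p. 31, via Lemma 1.2.1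
`H¹_f(ℚ_ℓ, T) ≅ T/(Fr_ℓ − 1)T`).  Proof: at the prime `𝔓₀` of the completion, with `σ₀ = res φ₀`
for a local Frobenius `φ₀` (`isArithFrobAt_absGaloisRestrict_adicCompletionPrime_iff`): `(→)`
evaluate the principal cocycle at `φ₀`; `(←)` `c ∘ res − ∂w` vanishes on `I_{K_v}` and at `φ₀`,
hence is zero (`contOneCocycles_eq_zero_of_absInertia_of_frob`).  For a general Frobenius `σ` at
`𝔓 = g • 𝔓₀`: `σ = i · g σ₀ g⁻¹` with `i ∈ I_𝔓` (`IsArithFrobAt.mul_inv_mem_inertia`), and the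
condition is insensitive to `i` (unramifiedness) and to conjugation (`apply_mem_range_conj_iff`).
[cite: MazurRubin2004, Prop. 3.6.1 proof (p. 31) and Lemma 1.2.1]
[cite: Rubin2011, Prop. 1.4.13 (1) (p. 9)] -/
theorem localization_oneCocycleClass_eq_zero_iff_of_isArithFrobAt (v : HeightOneSpectrum (𝓞 K))
    (hunr : GaloisRep.IsUnramifiedAt v ρ) (c : contOneCocycles ρ.toTopRep)
    (hc : ∀ 𝔓 ∈ v.primesAbove, ∀ g ∈ 𝔓.inertia (absoluteGaloisGroup K), c.1 g = 0)
    {𝔓 : Ideal (absIntegers (𝓞 K) K)} (h𝔓 : 𝔓 ∈ v.primesAbove) {σ : absoluteGaloisGroup K}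
    (hσ : IsArithFrobAt (𝓞 K) σ 𝔓) :
    galoisCohomology.localization ρ (Sum.inr v) 1 (oneCocycleClass ρ.toTopRep c) = 0 ↔
      c.1 σ ∈ ((ρ σ).toAddMonoidHom - AddMonoidHom.id M).range := by
  classical
  set L := v.adicCompletion K with hL
  set res := absGaloisRestrict K L with hres_def
  have h𝔓₀ := adicCompletionPrime_mem_primesAbove K v
  -- the local inertia acts trivially and `c` vanishes on it
  have hIρ : ∀ t ∈ absInertia L, ρ (res t) = 1 := fun t ht =>
    (GaloisRep.isUnramifiedAt_iff_toLocal_holds v ρ).1 hunr t ht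
  have hIres : ∀ t ∈ absInertia L, res t ∈ (adicCompletionPrime K v).inertia (absoluteGaloisGroup K) :=
    fun t ht => by
      rw [inertia_adicCompletionPrime_eq_map_absInertia]
      exact Subgroup.mem_map_of_mem _ ht
  have hIc : ∀ t ∈ absInertia L, c.1 (res t) = 0 := fun t ht => hc _ h𝔓₀ _ (hIres t ht)
  -- a local Frobenius `φ₀`; `res φ₀` is a Frobenius at `𝔓₀`
  obtain ⟨φ₀, hφ₀⟩ := exists_isAbsArithFrob_holds L
  have hφ₀1 : IsFrobPow φ₀ 1 := IsAbsArithFrob.isFrobPow_holds hφ₀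
  have hres0 : IsArithFrobAt (𝓞 K) (res φ₀) (adicCompletionPrime K v) :=
    (isArithFrobAt_absGaloisRestrict_adicCompletionPrime_iff K v
      (by rw [Literature.NumberTheory.Automorphic.residueFieldCard_adicCompletion_eq K v,
        HeightOneSpectrum.residueCard_eq_card_quotient]) φ₀).2 hφ₀
  -- Step A: the criterion at `σ₀ = res φ₀`
  have hA : galoisCohomology.localization ρ (Sum.inr v) 1 (oneCocycleClass ρ.toTopRep c) = 0 ↔
      c.1 (res φ₀) ∈ ((ρ (res φ₀)).toAddMonoidHom - AddMonoidHom.id M).range := by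
    rw [localization_inr_oneCocycleClass]
    refine (oneCocycleClass_eq_zero_iff _ _).trans ?_
    constructor
    · rintro ⟨w, hw⟩
      refine ⟨w, ?_⟩
      have h := hw φ₀
      rw [contOneCocycles.pullback_apply] at h
      exact h.symm
    · rintro ⟨w, hw⟩
      refine ⟨w, fun t => ?_⟩
      -- `ψ = c ∘ res − ∂w` vanishes on inertia and at `φ₀`, hence everywhere
      set ψ : contOneCocycles (DiscreteGaloisModule.toTopRep (GaloisRep.restrictField L ρ)) :=
        contOneCocycles.pullback res (X := ρ.toTopRep)
            (Y := DiscreteGaloisModule.toTopRep (GaloisRep.restrictField L ρ))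
            (TopRep.ofHom ⟨ContinuousLinearMap.id ℤ M, fun _ => rfl⟩) c -
          coboundaryCocycle (GaloisRep.restrictField L ρ) w with hψ_def
      have hψapply : ∀ x, ψ.1 x = c.1 (res x) - (ρ (res x) w - w) := fun x => rfl
      have hψI : ∀ t ∈ absInertia L, ψ.1 t = 0 := fun t ht => by
        rw [hψapply, hIc t ht, hIρ t ht, Module.End.one_apply, sub_self, sub_zero]
      have hψ0 : ψ.1 φ₀ = 0 := by
        rw [hψapply, sub_eq_zero]
        exact hw.symm
      have hψzero := contOneCocycles_eq_zero_of_absInertia_of_frob (GaloisRep.restrictField L ρ) ψ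
        hψI hφ₀1 hψ0
      have h := congrArg (fun χ : contOneCocycles _ => χ.1 t) hψzero
      simp only [hψapply] at h
      change c.1 (res t) - (ρ (res t) w - w) = 0 at h
      rw [sub_eq_zero] at h
      rw [contOneCocycles.pullback_apply]
      exact h
  -- Step B: transport to the given Frobenius `σ` at `𝔓 = g • 𝔓₀`
  obtain ⟨g, hg⟩ := HeightOneSpectrum.exists_smul_eq_of_mem_primesAbove_holds h𝔓₀ h𝔓
  have hconj : IsArithFrobAt (𝓞 K) (g * res φ₀ * g⁻¹) 𝔓 := hg ▸ hres0.conj g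
  have hi : σ * (g * res φ₀ * g⁻¹)⁻¹ ∈ 𝔓.inertia (absoluteGaloisGroup K) :=
    hσ.mul_inv_mem_inertia hconj
  have hσeq : σ = σ * (g * res φ₀ * g⁻¹)⁻¹ * (g * res φ₀ * g⁻¹) := by group
  rw [hA, hσeq, apply_mem_range_mul_iff_of_apply_eq_one c (hunr 𝔓 h𝔓 _ hi) (hc 𝔓 h𝔓 _ hi),
    apply_mem_range_conj_iff]

/-- The criterion in the `IsArithFrobAtPlace` spelling of `frobeniusClassPrimes`
(`∃ 𝔓 ∣ v, IsArithFrobAt σ 𝔓`). [cite: MazurRubin2004, Prop. 3.6.1 proof (p. 31)] -/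
theorem localization_oneCocycleClass_eq_zero_iff_of_isArithFrobAtPlace (v : HeightOneSpectrum (𝓞 K))
    (hunr : GaloisRep.IsUnramifiedAt v ρ) (c : contOneCocycles ρ.toTopRep)
    (hc : ∀ 𝔓 ∈ v.primesAbove, ∀ g ∈ 𝔓.inertia (absoluteGaloisGroup K), c.1 g = 0)
    {σ : absoluteGaloisGroup K} (hσ : IsArithFrobAtPlace K v σ) :
    galoisCohomology.localization ρ (Sum.inr v) 1 (oneCocycleClass ρ.toTopRep c) = 0 ↔
      c.1 σ ∈ ((ρ σ).toAddMonoidHom - AddMonoidHom.id M).range := by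
  obtain ⟨𝔓, h𝔓, hσ𝔓⟩ := hσ
  exact localization_oneCocycleClass_eq_zero_iff_of_isArithFrobAt ρ v hunr c hc h𝔓 hσ𝔓

end Global

end Summit.BirchSwinnertonDyer.Rank1Residual.GaloisImage.PrimeChoice

end
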